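import Summits.BirchSwinnertonDyer.BirchSwinnertonDyer.Theorems.SmallImageMuTransferMuTransferX9KolyvaginValueAssembled
import HarnessLib

/-!
# K6 crux `MuTransferX9` (stmt-BirchSwinnertonDyer-19276), skeleton v6d stub `stub_stepsTwoFourOdd`:
# the VALUE LINE of the assembler's hypothesis `hKoly`, from x10's key relation in koly's
# `valueInput` operator shape `ψ'(g) = (φ̃ − 1)((φ̃ − 1)(φ(g)))`, `φ̃ = (1+S)^{pⁿu}`

Cell `bsd-smallim`, seat `bsd-smallim-k6-g3` (gen 2).  THEOREMS ONLY (no definition, no named fact,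
no `sorry`).  HONEST FRAMING: helper toward the registered stub `stub_stepsTwoFourOdd` (skeleton v6d
`100eb8c6a7ccf73b`) of crux 19276; closes nothing.  PARTITION (D-0054): X9 (A4) × p ∈ {5,7}
(+ X10b∧¬Surj at 3: odd `p`, any field) — helper; closes NONE.  Companion of this seat's
`…X9KolyvaginValueAssembled` (p473750), in the SECOND input currency of the G3a producer: koly's
`TameClass.exists_tameCocycle_valueInput` (p471863) hands x10's `KolyvaginTwist.exists_kolyvaginCocycle_value`
(p469014) a norm-relation cocycle with VALUES `ψ'(g) = (φ̃ − 1)((φ̃ − 1)(φ g))`, `φ̃ = (1+S)^{pⁿ·u}`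
(`p ∤ u`) the action of every local Frobenius at `q` on `𝒯_{p^{n+1}}` (`hact`), and x10 returns the KEY
RELATION `𝒯_L(res r)·a' − a' = −ψ'(res r)` with `Φ_q(res τ_q) = −(a' mod T^J)` (koly's plug-check,
STATUS l.358).  This file is the remaining step to the VALUE LINE of lur-b's frozen `hKoly`
(HOME/lurb/STEPS24-hKoly.lean.txt, sha16 960563ac75c72708, consumed by p472462
`StepsTwoFour.stub_stepsTwoFourOdd_of`):
`∃ U : ℤ[X], ¬ (p:ℤ) ∣ U.coeff 0 ∧ c(res τ_q) = U(S) (S^{e'+1} (S^{a} (Φ(res r))))`.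

* `exists_poly_neg_castLE_eq_of_sub_one_sub_one` — pure algebra: from
  `(φ̃ − 1) a' = −(φ̃ − 1)((φ̃ − 1) t)` at level `L` (`J + pⁿ ≤ L`, `J ≤ 2pⁿ`) and the coboundary relation
  `(t mod T^J) − S^{a₀} v = (1+S)^c b − b` (`pⁿ ∣ c`): `−(a' mod T^J) = U(S)(S^{pⁿ}(S^{a₀} v))`,
  `p ∤ U(0)` (this seat's `neg_castLE_eq_shiftEnd_pow_aeval_castLE` + `shiftEnd_pow_aeval_apply_eq_of_sub_eq`).
* `twistModP_castLE`, `twistModP_apply_eq_unipotentPow_of_le` — the level-`J` action of `τ` from its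
  level-`L` action `hact` (truncation is equivariant), so the consumer supplies `hact` only.
* **`exists_poly_neg_castLE_eq_hKoly`** — the value line of `hKoly` VERBATIM at `τ := res r`, from the
  stub's tower data (`towerShift^[a] κ' = 𝐳̄`, `[Φ] = κ'_J`, `[φ₁] = 𝐳̄_{p^{n+1}}`), `e' + 1 = pⁿ`,
  `hact`, and the key relation as x10 prints it (`… = −ψτ`, `ψτ = (φ̃ − 1)((φ̃ − 1)(φ₁ τ))`).

References: HOME/koly/MU-TRANSFER-PROOF.md §3 Lemma 2 ("`κ_q(σ̄) = U·T^e·t_1 (mod T^{2e}𝒯)`");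
B. Perrin-Riou, Ann. Inst. Fourier 48 (1998) Prop. 3.1.6 [PerrinRiou1998AIF]; K. Rubin, *Euler Systems*
(2000) Lemma 4.4.2, Thm. 4.5.4 [Rubin2000]; L. Washington, *Introduction to Cyclotomic Fields* (1997)
§13.2 [Washington1997]; B. Mazur, K. Rubin, Mem. AMS 799 (2004) §5.3 [MazurRubin2004].
-/

-- the summit and its single problem are both named `BirchSwinnertonDyer` (registry layout D-0017)
set_option linter.dupNamespace false
set_option autoImplicit false

noncomputable section

open Function Finset Polynomial Field
open Literature.NumberTheory.GaloisRepresentations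
open Literature.NumberTheory.EllipticCurves
open Literature.NumberTheory.EllipticCurves.ZpExtension
open Summit.BirchSwinnertonDyer.BirchSwinnertonDyer.Rank1Residual.LocalSplitPrime

namespace Summit.BirchSwinnertonDyer.BirchSwinnertonDyer.Rank1Residual.KolyvaginTwist

/-! ### §1 Pure algebra: the value from `(φ̃ − 1) a' = −(φ̃ − 1)((φ̃ − 1) t)` -/

section Algebra

variable {M : Type*} [AddCommGroup M] {p : ℕ} [Fact p.Prime]

/-- **The value from the key relation in `valueInput` shape.**  On `Fin L → M` (`p·M = 0`) let
`φ̃ = (1+S)^{pᵐ·u}`, `p ∤ u`, and suppose `(φ̃ − 1) a' = −(φ̃ − 1)((φ̃ − 1) t)` (MU-TRANSFER-PROOF §3: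
`(φ̃ − 1)t_N = −P·t_1` with `P = (φ̃ − 1)²·unit`, Kato's `(1 − Fr⁻¹)²` at an `E`-split prime).  If at
level `J` (`J + pᵐ ≤ L`, `J ≤ 2pᵐ`) the truncation of `t` satisfies `(t mod T^J) − S^{a₀} v =
(1+S)^c b − b` with `pᵐ ∣ c`, then `−(a' mod T^J) = U(S)(S^{pᵐ}(S^{a₀} v))` for a polynomial
`U ∈ ℤ[X]` with `p ∤ U(0)` (`U = V`, `φ̃ − 1 = S^{pᵐ}·V(S)`, `V(0) = u`).
[cite: PerrinRiou1998AIF, Prop. 3.1.6] [cite: Washington1997, §13.2 (arithmetic in Λ/(p, T^n))] -/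
theorem exists_poly_neg_castLE_eq_of_sub_one_sub_one (hM : ∀ x : M, p • x = 0) (m u : ℕ)
    (hu : ¬ p ∣ u) {L J : ℕ} (hJL : J + p ^ m ≤ L) (hJ : J ≤ 2 * p ^ m) (a' t : Fin L → M)
    (hkey : (unipotentPow M L (p ^ m * u) - 1) a' =
      -((unipotentPow M L (p ^ m * u) - 1) ((unipotentPow M L (p ^ m * u) - 1) t)))
    {c : ℕ} (hc : p ^ m ∣ c) (v b : Fin J → M) (a₀ : ℕ)
    (hcob : (fun i : Fin J => t (Fin.castLE (by omega) i)) - (shiftEnd M J ^ a₀) v =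
      unipotentPow M J c b - b) :
    ∃ U : ℤ[X], ¬ ((p : ℤ) ∣ U.coeff 0) ∧
      (fun i : Fin J => -a' (Fin.castLE (by omega) i)) =
        aeval (shiftEnd M J) U ((shiftEnd M J ^ (p ^ m)) ((shiftEnd M J ^ a₀) v)) := by
  obtain ⟨V, hV0, hV⟩ := exists_poly_unipotentPow_sub_one_eq (J := L) hM m u
  have hrel : (unipotentPow M L (p ^ m * u) - 1) a' =
      -((unipotentPow M L (p ^ m * u) - 1)
        ((shiftEnd M L ^ (p ^ m)) (aeval (shiftEnd M L) V t))) := by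
    rw [hkey, ← Module.End.mul_apply (shiftEnd M L ^ (p ^ m)), ← hV]
  refine ⟨V, ?_, ?_⟩
  · rw [hV0, Int.natCast_dvd_natCast]
    exact hu
  · rw [neg_castLE_eq_shiftEnd_pow_aeval_castLE hM m u hu hJL a' t (p ^ m) V hrel,
      shiftEnd_pow_aeval_apply_eq_of_sub_eq hM hc hJ V _ v b a₀ hcob, pow_add, Module.End.mul_apply]

end Algebra

/-! ### §2 Galois currency: the level-`J` action from the level-`L` action, and the value line -/

section Galois

universe u

variable {K : Type u} [Field K] {p : ℕ} [Fact p.Prime] (κ : ZpExtension K p)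
  {M : Type u} [AddCommGroup M] [TopologicalSpace M] [DiscreteTopology M]
  (ρ : DiscreteGaloisModule K M) (hM : ∀ x : M, p • x = 0)

/-- **Truncation `𝒯_L → 𝒯_J` is equivariant, pointwise**: `(g·x) mod T^J = g·(x mod T^J)` (the
content of `twistModPTruncate`'s intertwining field). [cite: Washington1997, §13.1–§13.2] -/
theorem twistModP_castLE {L J : ℕ} (hJL : J ≤ L) (g : absoluteGaloisGroup K) (x : Fin L → M) :
    (fun i : Fin J => κ.twistModP ρ hM L g x (Fin.castLE hJL i)) =
      κ.twistModP ρ hM J g (fun i => x (Fin.castLE hJL i)) := by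
  rw [twistModP_apply, twistModP_apply, ← unipotentPow_twistExponent_of_le κ L hM hJL]
  exact unipotentPow_comp_castLE L hJL _ _

/-- **The level-`J` action from the level-`L` action.**  If `τ` acts on `𝒯_L` as `(1+S)^c`
(koly's `hact`: every local Frobenius at an `E`-split `q` of depth `n` acts on `𝒯_{p^{n+1}}` as
`(1+S)^{pⁿu}`), then it acts on `𝒯_J`, `J ≤ L`, as `(1+S)^c` too (truncate a zero-padded lift).
[cite: Washington1997, §13.1–§13.2] -/
theorem twistModP_apply_eq_unipotentPow_of_le {L J : ℕ} (hJL : J ≤ L) {τ : absoluteGaloisGroup K}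
    {c : ℕ} (hact : ∀ x : Fin L → M, κ.twistModP ρ hM L τ x = unipotentPow M L c x)
    (b : Fin J → M) : κ.twistModP ρ hM J τ b = unipotentPow M J c b := by
  -- zero-padded lift of `b` to level `L`
  let x : Fin L → M := fun i => if h : (i : ℕ) < J then b ⟨i, h⟩ else 0
  have hx : (fun i : Fin J => x (Fin.castLE hJL i)) = b := by
    funext i
    simp only [x, Fin.val_castLE, dif_pos i.2]
  rw [← hx, ← twistModP_castLE κ ρ hM hJL τ x, hact x]
  exact unipotentPow_comp_castLE L hJL c x

/-- **The value line of `hKoly`** (HOME/lurb/STEPS24-hKoly.lean.txt, consumed by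
`StepsTwoFour.stub_stepsTwoFourOdd_of`, p472462), at `τ := res r`.  Data: the stub's `a₀`, `κ'`,
`(κ.towerShift ρ hM)^[a₀] κ' = 𝐳̄` (`= I.redTower s`), `e' + 1 = pⁿ`, a cocycle `Φ` of `κ'_{2e'+2}` and
a cocycle `φ₁` of `𝐳̄_{p^{n+1}}` (koly's `φ`); `p` odd; an element `τ` acting on `𝒯_{p^{n+1}}` as
`φ̃ = (1+S)^{pⁿu}`, `p ∤ u` (koly's `hact r hr`); `a' ∈ 𝒯_{p^{n+1}}` with x10's key relation
`𝒯_{p^{n+1}}(τ) a' − a' = −ψτ` where `ψτ = (φ̃ − 1)((φ̃ − 1)(φ₁ τ))` (koly's `hψ' τ`).  THEN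
`∃ U : ℤ[X]`, `¬ (p:ℤ) ∣ U.coeff 0`, and
`(fun i ↦ −a' (Fin.castLE hJL i)) = aeval (shiftEnd M (2e'+1+1)) U ((shiftEnd …)^(e'+1) ((shiftEnd …)^a₀ (Φ τ)))`
— with x10's `Φ_q(res τ_q) = fun i ↦ −a' (Fin.castLE hJL i)` this is the value line VERBATIM
(MU-TRANSFER-PROOF Lemma 2: `κ_q(σ̄) = U·T^e·t_1 (mod T^{2e})`, `t_1` re-expressed through the stub's
`Φ` by `[φ₁ mod T^J] = [S^{a₀} ∘ Φ]`, the coboundary dying under `S^{pⁿ}` as `S^{2pⁿ} = 0`).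
[cite: PerrinRiou1998AIF, Prop. 3.1.6] [cite: Rubin2000, Lemma 4.4.2 and Thm. 4.5.4]
[cite: MazurRubin2004, §5.3] -/
theorem exists_poly_neg_castLE_eq_hKoly (hp2 : p ≠ 2) {a₀ : ℕ} (κ' z : κ.twistTower ρ hM)
    (hκ' : (κ.towerShift ρ hM)^[a₀] κ' = z) {n e' : ℕ} (he : e' + 1 = p ^ n)
    (hJL : 2 * e' + 1 + 1 ≤ p ^ (n + 1))
    (Φ : contOneCocycles (κ.twistModP ρ hM (2 * e' + 1 + 1)).toTopRep)
    (hΦ : oneCocycleClass (κ.twistModP ρ hM (2 * e' + 1 + 1)).toTopRep Φ = κ'.1 (2 * e' + 1 + 1))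
    (φ₁ : contOneCocycles (κ.twistModP ρ hM (p ^ (n + 1))).toTopRep)
    (hφ₁ : oneCocycleClass (κ.twistModP ρ hM (p ^ (n + 1))).toTopRep φ₁ = z.1 (p ^ (n + 1)))
    {τ : absoluteGaloisGroup K} {u : ℕ} (hu : ¬ p ∣ u)
    (hact : ∀ x : Fin (p ^ (n + 1)) → M,
      κ.twistModP ρ hM (p ^ (n + 1)) τ x = unipotentPow M (p ^ (n + 1)) (p ^ n * u) x)
    (a' ψτ : Fin (p ^ (n + 1)) → M)
    (hkey : κ.twistModP ρ hM (p ^ (n + 1)) τ a' - a' = -ψτ)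
    (hψ : ψτ = (unipotentPow M (p ^ (n + 1)) (p ^ n * u) - 1)
      ((unipotentPow M (p ^ (n + 1)) (p ^ n * u) - 1) (φ₁.1 τ))) :
    ∃ U : ℤ[X], ¬ ((p : ℤ) ∣ U.coeff 0) ∧
      (fun i : Fin (2 * e' + 1 + 1) => -a' (Fin.castLE hJL i)) =
        aeval (shiftEnd M (2 * e' + 1 + 1)) U
          ((shiftEnd M (2 * e' + 1 + 1) ^ (e' + 1)) ((shiftEnd M (2 * e' + 1 + 1) ^ a₀) (Φ.1 τ))) := by
  have hp : p.Prime := Fact.out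
  have h3 : 3 ≤ p := Nat.succ_le_of_lt (lt_of_le_of_ne hp.two_le (Ne.symm hp2))
  have hJ : 2 * e' + 1 + 1 ≤ 2 * p ^ n := by rw [← he]; omega
  have hJL' : 2 * e' + 1 + 1 + p ^ n ≤ p ^ (n + 1) :=
    calc 2 * e' + 1 + 1 + p ^ n = 3 * p ^ n := by rw [← he]; ring
      _ ≤ p * p ^ n := Nat.mul_le_mul_right _ h3
      _ = p ^ (n + 1) := by rw [pow_succ']
  -- the key relation in the division lemma's shape
  have hkey' : (unipotentPow M (p ^ (n + 1)) (p ^ n * u) - 1) a' =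
      -((unipotentPow M (p ^ (n + 1)) (p ^ n * u) - 1)
        ((unipotentPow M (p ^ (n + 1)) (p ^ n * u) - 1) (φ₁.1 τ))) := by
    rw [LinearMap.sub_apply, Module.End.one_apply, ← hact a', hkey, hψ]
  -- the coboundary relation at level `J`, with `τ` acting as `(1+S)^{pⁿu}` there too
  obtain ⟨b, hb⟩ := exists_coboundary_apply_of_towerShift_iterate_eq κ ρ hM κ' z hκ' hJL Φ hΦ φ₁ hφ₁
  have hcob := hb τ
  rw [twistModP_apply_eq_unipotentPow_of_le κ ρ hM hJL hact b] at hcob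
  rw [he]
  exact exists_poly_neg_castLE_eq_of_sub_one_sub_one hM n u hu hJL' hJ a' (φ₁.1 τ) hkey'
    (dvd_mul_right (p ^ n) u) (Φ.1 τ) b a₀ hcob

end Galois

end Summit.BirchSwinnertonDyer.BirchSwinnertonDyer.Rank1Residual.KolyvaginTwist

end
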